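import Literature.AlgebraicGeometry.Resolution.ResolutionGlue
import Mathlib.AlgebraicGeometry.IdealSheaf.Functorial
import Mathlib.AlgebraicGeometry.Noetherian
import HarnessLib

/-!
# Gluing resolutions of the irreducible components — the narrow-import module

Topic: `Literature/AlgebraicGeometry/Resolution`. Definition item `defn-ComponentGluing` (cone
hygiene for the routes of the summit `ResolutionOfSingularities`): the PROVED folklore glue by which
resolution of singularities of a reduced scheme is reduced to its irreducible components (with their
reduced = integral closed-subscheme structure), collected in ONE module whose import cone is only
`ResolutionGlue` → `ResolutionOfSingularities` → Mathlib (plus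
`Mathlib.AlgebraicGeometry.IdealSheaf.Functorial`, `Mathlib.AlgebraicGeometry.Noetherian`). Before
this module the same lemmas were reachable only through `ResolutionOfCurves.lean`
(→ `ResolutionLU`, `ArithmeticalThreefolds`, `LocalUniformization`, `Alterations`, …), so every
route or `Theorems/` file using them carried the unproved named facts of
those files (`CossartJannsenSaito2020`, `CossartPiltant2019LU3`, `CossartPiltant2019Patching`,
`Temkin2013`, `AbramovichOortConjecture`, …) in its import cone although none of them is a
hypothesis of anything here. A file that needs only this glue imports
`Literature.AlgebraicGeometry.Resolution.ComponentGluing` and refers to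
`Literature.AlgebraicGeometry.Resolution.ComponentGluing.<name>`.

## Naming (why a sub-namespace and not a plain move)

Every declaration below is the canonical, fully proved copy of a lemma that first landed in
`ResolutionOfCurves.lean` (reduced closed subschemes), `ResolutionOfComponents.lean` (the glue and
the induction over the components) or `QuasiProjectiveResolution.lean` (composition of birational
morphisms), under the SAME short name inside the sub-namespace `ComponentGluing`:
`ComponentGluing.<name>` ↔ old `<name>`. A literal move keeping the fully-qualified names is not
expressible through the gate (one fully-qualified name belongs to one module, and a declaration that
importers reference cannot be removed from its module), so the old names stay where they are — as
one-line restatements `theorem <name> … := ComponentGluing.<name> …` once those files import this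
module — and nothing downstream changes. Dot notation (`h.comp`, `h.of_iso`) keeps working through
the old names; from this module use `ComponentGluing.IsBirational.comp h' h` etc. (or
`open Literature.AlgebraicGeometry.Resolution.ComponentGluing` in a file that does not also import
the old ones).

## Content (all proved; [folklore] unless cited)

* reduced closed subschemes `(vanishingIdeal Z).subscheme` (Mathlib ideal sheaves):
  `isReduced_subscheme_vanishingIdeal`, `mem_of_subscheme_vanishingIdeal`,
  `range_subschemeι_vanishingIdeal`, `isIntegral_subscheme_vanishingIdeal` (for `Z` irreducible),
  `isEmpty_subscheme_vanishingIdeal_bot`, `isIso_subschemeι_vanishingIdeal_top`, the inclusion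
  `X_Z ↪ X_{Z'}` for `Z ≤ Z'` (Mathlib `IdealSheafData.inclusion`): `subschemeι_inclusion_apply`,
  `range_inclusion`; `mem_of_subset_biUnion_of_mem_irreducibleComponents`;
* birational morphisms: `IsBirational.irreducibleSpace`, `IsBirational.comp`,
  `Scheme.HasResolution.of_isBirational` (proper birational morphisms transport resolutions);
* the glue (Cossart–Piltant 2019, proof of Prop. 4.6, Step 1): `isProper_coprodDesc`,
  `isBirational_coprodDesc_of_closed_cover`, `hasResolution_of_closed_cover`,
  `Scheme.HasResolution.of_iso`, `hasResolution_subscheme_biUnion`,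
  `hasResolution_of_irreducibleComponents`, `isIntegral_subscheme_of_mem_irreducibleComponents`,
  `hasResolution_of_forall_closeds`;
* the resolution statements of `ResolutionOfSingularities.lean` are equivalent to their integral
  cases, stated here WITHOUT the abbreviation `IntegralResolutionInChar` (which stays, with
  `IntegralResolutionOverUpToDim` and the `ResolutionOverUpToDim` / `CossartPiltant2019`
  corollaries, in `ResolutionOfComponents.lean`): `resolutionInChar_iff_integral`,
  `hironaka1964_iff_integral`, `resolutionOfSingularities_iff_integral` — the right-hand sides are
  the unfolded `∀ k, [CharP k p] → ∀ X f, separated → finite type → integral → HasResolution X`, so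
  the old statements are these ones up to unfolding `IntegralResolutionInChar`.

Deliberately NOT here: anything needing normalization, dimension theory or local uniformization
(the curve case `ResolutionOfCurves.lean`, `ResolutionOverUpToDim`).

## Sources

* V. Cossart, O. Piltant, *Resolution of singularities of arithmetical threefolds*, J. Algebra 529
  (2019) 268–535, proof of Prop. 4.6, Step 1 (arXiv:1412.0868 v1: Prop. 4.4): "There is a finite
  birational morphism `f : ∐ᵢ 𝒳ᵢ → 𝒳` … The theorem holds for `𝒳` if it holds for each `𝒳ᵢ`."
* J. Kollár, *Lectures on Resolution of Singularities*, Ann. of Math. Stud. 166, PUP 2007, Ch. 3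
  (resolution is constructed component by component), §1.4.
* R. Hartshorne, *Algebraic Geometry*, GTM 52, Ch. V, Rem. 3.8.1 (context).
-/

noncomputable section

open CategoryTheory CategoryTheory.Limits AlgebraicGeometry TopologicalSpace Topology

namespace Literature.AlgebraicGeometry.Resolution

universe u

namespace ComponentGluing

/-! ## Reduced closed subschemes -/

section ReducedSubscheme

open Scheme.IdealSheafData

variable {X : Scheme.{u}}

/-- The closed subscheme of `X` defined by the vanishing ideal sheaf of a closed subset `Z` (the
reduced induced structure on `Z`) is reduced. [folklore] -/
theorem isReduced_subscheme_vanishingIdeal (Z : Closeds X) :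
    IsReduced (vanishingIdeal Z).subscheme := by
  haveI : ∀ U, IsReduced ((vanishingIdeal Z).subschemeCover.openCover.X U) := by
    intro (U : X.affineOpens)
    change IsReduced (Spec (.of (Γ(X, (U : X.Opens)) ⧸ (vanishingIdeal Z).ideal U)))
    haveI : _root_.IsReduced (Γ(X, (U : X.Opens)) ⧸ (vanishingIdeal Z).ideal U) := by
      rw [← Ideal.isRadical_iff_quotient_reduced, vanishingIdeal_ideal]
      exact PrimeSpectrum.isRadical_vanishingIdeal _
    infer_instance
  exact IsReduced.of_openCover _ (vanishingIdeal Z).subschemeCover.openCover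

/-- The points of the reduced closed subscheme on `Z` are the points of `Z`. [folklore] -/
theorem mem_of_subscheme_vanishingIdeal (Z : Closeds X) (x : (vanishingIdeal Z).subscheme) :
    (vanishingIdeal Z).subschemeι x ∈ Z := by
  have := x.2
  rw [subschemeι_apply]
  rwa [← SetLike.mem_coe, coe_support_vanishingIdeal] at this

/-- The range of the inclusion of the reduced closed subscheme on `Z` is `Z`. [folklore] -/
theorem range_subschemeι_vanishingIdeal (Z : Closeds X) :
    Set.range (vanishingIdeal Z).subschemeι = (Z : Set X) := by
  rw [range_subschemeι, coe_support_vanishingIdeal]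

/-- The reduced closed subscheme on an irreducible closed subset is an integral scheme.
[folklore] -/
theorem isIntegral_subscheme_vanishingIdeal (Z : Closeds X) (hZ : IsIrreducible (Z : Set X)) :
    IsIntegral (vanishingIdeal Z).subscheme := by
  haveI : IrreducibleSpace (vanishingIdeal Z).subscheme := by
    have e : ((vanishingIdeal Z).support : Set X) = Z := coe_support_vanishingIdeal Z
    have : IsIrreducible ((vanishingIdeal Z).support : Set X) := by rw [e]; exact hZ
    exact Subtype.irreducibleSpace this
  haveI := isReduced_subscheme_vanishingIdeal Z
  exact isIntegral_of_irreducibleSpace_of_isReduced _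

/-- The reduced closed subscheme on the empty closed subset is empty. [folklore] -/
theorem isEmpty_subscheme_vanishingIdeal_bot :
    IsEmpty (vanishingIdeal (⊥ : Closeds X)).subscheme := by
  rw [vanishingIdeal_bot]
  infer_instance

/-- For a reduced scheme, the inclusion of the reduced closed subscheme on all of `X` is an
isomorphism. [folklore] -/
theorem isIso_subschemeι_vanishingIdeal_top [IsReduced X] :
    IsIso (vanishingIdeal (⊤ : Closeds X)).subschemeι := by
  rw [Scheme.isIso_subschemeι_iff_eq_bot, vanishingIdeal_top, Scheme.nilradical_eq_bot]

/-! The inclusion `inclusion h : X_Z ⟶ X_{Z'}` between the reduced closed subschemes on closed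
subsets `Z ≤ Z'` (Mathlib's `IdealSheafData.inclusion`, for
`h : vanishingIdeal Z' ≤ vanishingIdeal Z`, e.g. `h = vanishingIdeal_antimono _`). -/

/-- The inclusion `X_Z ↪ X_{Z'}` is the identity on underlying points of `X`. [folklore] -/
theorem subschemeι_inclusion_apply {Z Z' : Closeds X} (h : vanishingIdeal Z' ≤ vanishingIdeal Z)
    (x : (vanishingIdeal Z).subscheme) :
    ((vanishingIdeal Z').subschemeι (inclusion h x) : X) = (vanishingIdeal Z).subschemeι x := by
  rw [← Scheme.Hom.comp_apply, inclusion_subschemeι]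

/-- The range of the inclusion `X_Z ↪ X_{Z'}` of reduced closed subschemes consists of the points
of `X_{Z'}` lying in `Z`. [folklore] -/
theorem range_inclusion {Z Z' : Closeds X} (h : vanishingIdeal Z' ≤ vanishingIdeal Z) :
    Set.range (inclusion h) = (vanishingIdeal Z').subschemeι ⁻¹' (Z : Set X) := by
  ext y
  constructor
  · rintro ⟨x, rfl⟩
    show (vanishingIdeal Z').subschemeι (inclusion h x) ∈ (Z : Set X)
    rw [subschemeι_inclusion_apply]
    exact mem_of_subscheme_vanishingIdeal Z x
  · intro hy
    have hy' : (vanishingIdeal Z').subschemeι y ∈ Set.range (vanishingIdeal Z).subschemeι := by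
      rw [range_subschemeι_vanishingIdeal]; exact hy
    obtain ⟨x, hx⟩ := hy'
    refine ⟨x, ?_⟩
    apply (vanishingIdeal Z').subschemeι.isClosedEmbedding.injective
    rw [subschemeι_inclusion_apply, hx]

end ReducedSubscheme

/-! ## Irreducible components -/

/-- An irreducible component contained in a finite union of irreducible components is one of
them. [folklore] -/
theorem mem_of_subset_biUnion_of_mem_irreducibleComponents {α : Type*} [TopologicalSpace α]
    {Z : Set α} (hZ : Z ∈ irreducibleComponents α) (S : Finset (Set α))
    (hS : (S : Set (Set α)) ⊆ irreducibleComponents α) (h : Z ⊆ ⋃ W ∈ S, W) :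
    Z ∈ S := by
  have h' : Z ⊆ ⋃₀ (S : Set (Set α)) := by rwa [Set.sUnion_eq_biUnion]
  obtain ⟨W, hWS, hZW⟩ := isIrreducible_iff_sUnion_isClosed.mp hZ.1 S
    (fun W hW => isClosed_of_mem_irreducibleComponents W (hS hW)) h'
  have hWZ : W = Z := Set.Subset.antisymm (hZ.2 (hS hWS).1 hZW) hZW
  rw [← hWZ]; exact hWS

/-! ## Birational morphisms compose -/

section Birational

variable {X'' X' X : Scheme.{u}}

/-- The source of a birational morphism onto an irreducible scheme is irreducible: it contains
the dense open `π⁻¹(U) ≅ U`, and `U ≠ ∅` is irreducible. [folklore] -/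
theorem IsBirational.irreducibleSpace {π : X' ⟶ X} (h : IsBirational π) [IrreducibleSpace X] :
    IrreducibleSpace X' := by
  obtain ⟨U, hU, hU', hiso⟩ := h
  obtain ⟨x, hx⟩ := hU.nonempty
  haveI : Nonempty (↑(π ⁻¹ᵁ U) : Scheme.{u}) :=
    ⟨(Scheme.homeoOfIso (asIso (π ∣_ U))).symm ⟨x, hx⟩⟩
  haveI : IrreducibleSpace (↑(π ⁻¹ᵁ U) : Scheme.{u}) :=
    ((π ∣_ U) ≫ U.ι).isOpenEmbedding.irreducibleSpace
  have h1 : IsIrreducible ((π ⁻¹ᵁ U : X'.Opens) : Set X') := by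
    rw [← Scheme.Opens.range_ι, ← Set.image_univ]
    exact (IrreducibleSpace.isIrreducible_univ _).image _
      (π ⁻¹ᵁ U).ι.continuous.continuousOn
  have h2 := h1.closure
  rw [hU'.closure_eq] at h2
  exact (irreducibleSpace_def X').mpr h2

/-- **Birational morphisms compose**: if `π : X' → X` is an isomorphism over the dense open `U`
with `π⁻¹(U)` dense, and `π' : X'' → X'` over the dense open `V` with `π'⁻¹(V)` dense, then
`π' ≫ π` is an isomorphism over the open `W ⊆ U` corresponding to `π⁻¹(U) ∩ V` under
`π⁻¹(U) ≅ U`; `W` is dense in `X` (a dense open meets a dense set densely) and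
`(π' ≫ π)⁻¹(W) = π'⁻¹(π⁻¹(U) ∩ V)` is dense in `π'⁻¹(V) ≅ V`, hence in `X''`. [folklore] -/
theorem IsBirational.comp {π' : X'' ⟶ X'} {π : X' ⟶ X}
    (h' : IsBirational π') (h : IsBirational π) : IsBirational (π' ≫ π) := by
  obtain ⟨U, hU, hπU, hisoU⟩ := h
  obtain ⟨V, hV, hπV, hisoV⟩ := h'
  -- the open `W ⊆ U` corresponding to `π⁻¹ U ∩ V` under the isomorphism `π⁻¹ U ≅ U`
  set S : (↑(π ⁻¹ᵁ U) : Scheme.{u}).Opens := (π ⁻¹ᵁ U).ι ⁻¹ᵁ V with hS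
  set W : X.Opens := U.ι ''ᵁ ((π ∣_ U) ''ᵁ S) with hWdef
  have hWU : W ≤ U := U.ι_image_le _
  have hW : π ⁻¹ᵁ W = π ⁻¹ᵁ U ⊓ V := by
    have h1 : (π ⁻¹ᵁ U).ι ⁻¹ᵁ (π ⁻¹ᵁ W) = S := by
      rw [← Scheme.Hom.comp_preimage, ← morphismRestrict_ι, Scheme.Hom.comp_preimage, hWdef,
        Scheme.Hom.preimage_image_eq, Scheme.Hom.preimage_image_eq]
    have h2 : π ⁻¹ᵁ W ≤ π ⁻¹ᵁ U := π.preimage_mono hWU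
    calc π ⁻¹ᵁ W = (π ⁻¹ᵁ U).ι ''ᵁ ((π ⁻¹ᵁ U).ι ⁻¹ᵁ (π ⁻¹ᵁ W)) := by
          rw [Scheme.Hom.image_preimage_eq_opensRange_inf, Scheme.Opens.opensRange_ι,
            inf_eq_right.mpr h2]
      _ = (π ⁻¹ᵁ U).ι ''ᵁ S := by rw [h1]
      _ = π ⁻¹ᵁ U ⊓ V := by
          rw [hS, Scheme.Hom.image_preimage_eq_opensRange_inf, Scheme.Opens.opensRange_ι]
  -- `W` is dense in `X`
  have hSd : Dense (S : Set (↑(π ⁻¹ᵁ U) : Scheme.{u})) :=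
    hV.preimage (π ⁻¹ᵁ U).2.isOpenMap_subtype_val
  have hTd : Dense (((π ∣_ U) ''ᵁ S : (↑U : Scheme.{u}).Opens) : Set (↑U : Scheme.{u})) := by
    rw [Scheme.Hom.coe_image]
    exact (Scheme.homeoOfIso (asIso (π ∣_ U))).surjective.denseRange.dense_image
      (π ∣_ U).continuous hSd
  have hWd : Dense (W : Set X) := by
    rw [hWdef, Scheme.Hom.coe_image]
    exact hU.denseRange_val.dense_image continuous_subtype_val hTd
  -- `π'⁻¹ (π⁻¹ U ∩ V)` is dense in `X''`
  have hPd : Dense ((π ⁻¹ᵁ U ⊓ V : X'.Opens) : Set X') :=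
    hπU.inter_of_isOpen_right hV V.2
  have hpre : Dense ((π' ⁻¹ᵁ (π ⁻¹ᵁ U ⊓ V) : X''.Opens) : Set X'') := by
    have h1 : Dense ((V.ι ⁻¹ᵁ (π ⁻¹ᵁ U ⊓ V) : (↑V : Scheme.{u}).Opens) : Set (↑V : Scheme.{u})) :=
      hPd.preimage V.2.isOpenMap_subtype_val
    have h2 : Dense ((((π' ∣_ V) ⁻¹ᵁ (V.ι ⁻¹ᵁ (π ⁻¹ᵁ U ⊓ V)) :
        (↑(π' ⁻¹ᵁ V) : Scheme.{u}).Opens) : Set (↑(π' ⁻¹ᵁ V) : Scheme.{u}))) :=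
      h1.preimage (Scheme.homeoOfIso (asIso (π' ∣_ V))).isOpenMap
    have h3 : (π' ∣_ V) ⁻¹ᵁ (V.ι ⁻¹ᵁ (π ⁻¹ᵁ U ⊓ V)) =
        (π' ⁻¹ᵁ V).ι ⁻¹ᵁ (π' ⁻¹ᵁ (π ⁻¹ᵁ U ⊓ V)) := by
      rw [← Scheme.Hom.comp_preimage, morphismRestrict_ι, Scheme.Hom.comp_preimage]
    rw [h3] at h2
    have h4 := hπV.denseRange_val.dense_image continuous_subtype_val h2
    have hQ : ((π' ⁻¹ᵁ (π ⁻¹ᵁ U ⊓ V) : X''.Opens) : Set X'') ⊆ (π' ⁻¹ᵁ V : Set X'') :=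
      fun x hx => hx.2
    convert h4 using 1
    ext x
    constructor
    · intro hx; exact ⟨⟨x, hQ hx⟩, hx, rfl⟩
    · rintro ⟨y, hy, rfl⟩; exact hy
  refine ⟨W, hWd, ?_, ?_⟩
  · rw [Scheme.Hom.comp_preimage, hW]
    exact hpre
  · rw [morphismRestrict_comp]
    haveI h1 : IsIso (π' ∣_ π ⁻¹ᵁ W) :=
      isIso_morphismRestrict_of_le π' hisoV (hW ▸ inf_le_right)
    haveI h2 : IsIso (π ∣_ W) := isIso_morphismRestrict_of_le π hisoU hWU
    exact IsIso.comp_isIso (f := π' ∣_ π ⁻¹ᵁ W) (h := π ∣_ W)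

/-- **Proper birational morphisms transport resolutions**: if `ρ : X' → X` is proper and
birational and `X'` has a resolution `Y → X'`, then `Y → X' → X` is a resolution of `X`.
[folklore] -/
theorem Scheme.HasResolution.of_isBirational (ρ : X' ⟶ X) [IsProper ρ] (hρ : IsBirational ρ)
    (h : Scheme.HasResolution X') : Scheme.HasResolution X := by
  obtain ⟨Y, π, hπ⟩ := h
  haveI := hπ.isProper
  exact ⟨Y, π ≫ ρ, ⟨inferInstance, IsBirational.comp hπ.isBirational hρ, hπ.isRegular⟩⟩

end Birational

/-! ## Properness and birationality of `C' ⨿ D' → X` -/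

section Glue

/-- `coprod.desc f g : U ⨿ V ⟶ X` is proper when `f` and `g` are (it factors as
`coprod.map f g` — proper, the property being local on the target — followed by the finite fold
map `X ⨿ X ⟶ X`). [folklore] -/
theorem isProper_coprodDesc {U V X : Scheme.{u}} (f : U ⟶ X) (g : V ⟶ X) [IsProper f]
    [IsProper g] : IsProper (coprod.desc f g) := by
  have h1 : IsProper (coprod.map f g) := IsZariskiLocalAtTarget.coprodMap f g ‹_› ‹_›
  have h2 : IsProper (coprod.desc (𝟙 X) (𝟙 X)) := inferInstance
  have : coprod.desc f g = coprod.map f g ≫ coprod.desc (𝟙 X) (𝟙 X) := by simp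
  rw [this]
  infer_instance

/-- **Birationality of `C' ⨿ D' → X` along a closed cover.** Let the reduced scheme `X` be covered
by two closed subschemes `ι₁ : C ↪ X`, `ι₂ : D ↪ X` such that the complement of `D` is dense in
`C` and the complement of `C` is dense in `D`. If `ρ₁ : C' → C` and `ρ₂ : D' → D` are birational,
so is `coprod.desc (ρ₁ ≫ ι₁) (ρ₂ ≫ ι₂) : C' ⨿ D' → X` (it is an isomorphism over the dense open
`(O₁ ∖ D) ∪ (O₂ ∖ C)`, where `ρᵢ` is an isomorphism over `Oᵢ`).
[cite: CossartPiltant2019, proof of Prop. 4.6, Step 1 (arXiv v1: Prop. 4.4)] -/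
theorem isBirational_coprodDesc_of_closed_cover {C D C' D' X : Scheme.{u}} [IsReduced X]
    (ι₁ : C ⟶ X) (ι₂ : D ⟶ X) [IsClosedImmersion ι₁] [IsClosedImmersion ι₂]
    (hcov : Set.range ι₁ ∪ Set.range ι₂ = Set.univ)
    (hd₁ : Dense (ι₁ ⁻¹' (Set.range ι₂)ᶜ)) (hd₂ : Dense (ι₂ ⁻¹' (Set.range ι₁)ᶜ))
    {ρ₁ : C' ⟶ C} {ρ₂ : D' ⟶ D} (hρ₁ : IsBirational ρ₁) (hρ₂ : IsBirational ρ₂) :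
    IsBirational (coprod.desc (ρ₁ ≫ ι₁) (ρ₂ ≫ ι₂)) := by
  obtain ⟨W₁, hW₁, hW₁', hiso₁⟩ := hρ₁
  obtain ⟨W₂, hW₂, hW₂', hiso₂⟩ := hρ₂
  -- the open complements of the two closed pieces
  let A : X.Opens := ⟨(Set.range ι₂)ᶜ, ι₂.isClosedEmbedding.isClosed_range.isOpen_compl⟩
  let B : X.Opens := ⟨(Set.range ι₁)ᶜ, ι₁.isClosedEmbedding.isClosed_range.isOpen_compl⟩
  have hA : (A : Set X) ⊆ Set.range ι₁ := by
    intro x hx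
    have hx' : x ∈ Set.range ι₁ ∪ Set.range ι₂ := by rw [hcov]; trivial
    exact hx'.resolve_right hx
  have hB : (B : Set X) ⊆ Set.range ι₂ := by
    intro x hx
    have hx' : x ∈ Set.range ι₁ ∪ Set.range ι₂ := by rw [hcov]; trivial
    exact hx'.resolve_left hx
  -- opens of `X` inducing `W₁`, `W₂`
  obtain ⟨O₁, hO₁, hO₁W⟩ := ι₁.isClosedEmbedding.isInducing.isOpen_iff.mp W₁.2
  obtain ⟨O₂, hO₂, hO₂W⟩ := ι₂.isClosedEmbedding.isInducing.isOpen_iff.mp W₂.2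
  let V₁ : X.Opens := ⟨O₁, hO₁⟩ ⊓ A
  let V₂ : X.Opens := ⟨O₂, hO₂⟩ ⊓ B
  have hV₁W : ι₁ ⁻¹ᵁ V₁ ≤ W₁ := by
    intro c hc
    have hc' : ι₁ c ∈ O₁ := hc.1
    have : c ∈ ι₁ ⁻¹' O₁ := hc'
    rw [hO₁W] at this
    exact this
  have hV₂W : ι₂ ⁻¹ᵁ V₂ ≤ W₂ := by
    intro d hd
    have hd' : ι₂ d ∈ O₂ := hd.1
    have : d ∈ ι₂ ⁻¹' O₂ := hd'
    rw [hO₂W] at this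
    exact this
  let π : C' ⨿ D' ⟶ X := coprod.desc (ρ₁ ≫ ι₁) (ρ₂ ≫ ι₂)
  have hπ₁ : ∀ c' : C', π ((coprod.inl : C' ⟶ C' ⨿ D') c') = ι₁ (ρ₁ c') := by
    intro c'
    rw [← Scheme.Hom.comp_apply, coprod.inl_desc, Scheme.Hom.comp_apply]
  have hπ₂ : ∀ d' : D', π ((coprod.inr : D' ⟶ C' ⨿ D') d') = ι₂ (ρ₂ d') := by
    intro d'
    rw [← Scheme.Hom.comp_apply, coprod.inr_desc, Scheme.Hom.comp_apply]
  -- the dense pieces upstairs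
  have hS₁ : Dense ((W₁ : Set C) ∩ ι₁ ⁻¹' (A : Set X)) := hW₁.inter_of_isOpen_left hd₁ W₁.2
  have hS₂ : Dense ((W₂ : Set D) ∩ ι₂ ⁻¹' (B : Set X)) := hW₂.inter_of_isOpen_left hd₂ W₂.2
  have hS₁V : ι₁ '' ((W₁ : Set C) ∩ ι₁ ⁻¹' (A : Set X)) ⊆ (V₁ : Set X) := by
    rintro _ ⟨c, ⟨hcW, hcA⟩, rfl⟩
    refine ⟨?_, hcA⟩
    have : c ∈ ι₁ ⁻¹' O₁ := by rw [hO₁W]; exact hcW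
    exact this
  have hS₂V : ι₂ '' ((W₂ : Set D) ∩ ι₂ ⁻¹' (B : Set X)) ⊆ (V₂ : Set X) := by
    rintro _ ⟨d, ⟨hdW, hdB⟩, rfl⟩
    refine ⟨?_, hdB⟩
    have : d ∈ ι₂ ⁻¹' O₂ := by rw [hO₂W]; exact hdW
    exact this
  refine ⟨V₁ ⊔ V₂, ?_, ?_, ?_⟩
  · -- `V₁ ∪ V₂` is dense in `X`
    intro x
    have hx : x ∈ Set.range ι₁ ∪ Set.range ι₂ := by rw [hcov]; trivial
    rcases hx with ⟨c, rfl⟩ | ⟨d, rfl⟩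
    · have h1 : ι₁ c ∈ closure (ι₁ '' ((W₁ : Set C) ∩ ι₁ ⁻¹' (A : Set X))) :=
        image_closure_subset_closure_image ι₁.continuous ⟨c, hS₁ c, rfl⟩
      exact closure_mono (hS₁V.trans Set.subset_union_left) h1
    · have h2 : ι₂ d ∈ closure (ι₂ '' ((W₂ : Set D) ∩ ι₂ ⁻¹' (B : Set X))) :=
        image_closure_subset_closure_image ι₂.continuous ⟨d, hS₂ d, rfl⟩
      exact closure_mono (hS₂V.trans Set.subset_union_right) h2
  · -- the preimage of `V₁ ∪ V₂` is dense in `C' ⨿ D'`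
    have hT₁ : Dense (ρ₁ ⁻¹' ((W₁ : Set C) ∩ ι₁ ⁻¹' (A : Set X))) :=
      dense_preimage_inter_of_isIso_morphismRestrict ρ₁ hiso₁ hW₁' hd₁
    have hT₂ : Dense (ρ₂ ⁻¹' ((W₂ : Set D) ∩ ι₂ ⁻¹' (B : Set X))) :=
      dense_preimage_inter_of_isIso_morphismRestrict ρ₂ hiso₂ hW₂' hd₂
    refine (dense_inl_image_union_inr_image hT₁ hT₂).mono ?_
    rintro z (⟨c', hc', rfl⟩ | ⟨d', hd', rfl⟩)
    · show π ((coprod.inl : C' ⟶ C' ⨿ D') c') ∈ V₁ ⊔ V₂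
      rw [hπ₁]
      exact Or.inl (hS₁V ⟨ρ₁ c', hc', rfl⟩)
    · show π ((coprod.inr : D' ⟶ C' ⨿ D') d') ∈ V₁ ⊔ V₂
      rw [hπ₂]
      exact Or.inr (hS₂V ⟨ρ₂ d', hd', rfl⟩)
  · -- `π` is an isomorphism over `V₁ ∪ V₂`
    refine isIso_morphismRestrict_sup π ?_ ?_
    · refine isIso_morphismRestrict_coprodDesc_left _ _ V₁ (fun d' h => ?_) ?_
      · rw [Scheme.Hom.comp_apply] at h
        exact h.2 ⟨ρ₂ d', rfl⟩
      · rw [morphismRestrict_comp]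
        have e1 : IsIso (ρ₁ ∣_ ι₁ ⁻¹ᵁ V₁) := isIso_morphismRestrict_of_le ρ₁ hiso₁ hV₁W
        have e2 : IsIso (ι₁ ∣_ V₁) :=
          isIso_morphismRestrict_of_isClosedImmersion ι₁ V₁ fun x hx => hA hx.2
        exact @IsIso.comp_isIso _ _ _ _ _ _ _ e1 e2
    · refine isIso_morphismRestrict_coprodDesc_right _ _ V₂ (fun c' h => ?_) ?_
      · rw [Scheme.Hom.comp_apply] at h
        exact h.2 ⟨ρ₁ c', rfl⟩
      · rw [morphismRestrict_comp]
        have e1 : IsIso (ρ₂ ∣_ ι₂ ⁻¹ᵁ V₂) := isIso_morphismRestrict_of_le ρ₂ hiso₂ hV₂W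
        have e2 : IsIso (ι₂ ∣_ V₂) :=
          isIso_morphismRestrict_of_isClosedImmersion ι₂ V₂ fun x hx => hB hx.2
        exact @IsIso.comp_isIso _ _ _ _ _ _ _ e1 e2

/-- **Gluing resolutions along a closed cover** ("the theorem holds for `𝒳` if it holds for each
`𝒳ᵢ`"): if the reduced scheme `X` is covered by closed subschemes `C`, `D` with mutually dense
complements and `C`, `D` admit resolutions of singularities, so does `X` — the disjoint union
`C' ⨿ D' → X` of the two resolutions is proper (`isProper_coprodDesc`), birational
(`isBirational_coprodDesc_of_closed_cover`) and has regular source.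
[cite: CossartPiltant2019, proof of Prop. 4.6, Step 1 (arXiv v1: Prop. 4.4)] -/
theorem hasResolution_of_closed_cover {C D X : Scheme.{u}} [IsReduced X]
    (ι₁ : C ⟶ X) (ι₂ : D ⟶ X) [IsClosedImmersion ι₁] [IsClosedImmersion ι₂]
    (hcov : Set.range ι₁ ∪ Set.range ι₂ = Set.univ)
    (hd₁ : Dense (ι₁ ⁻¹' (Set.range ι₂)ᶜ)) (hd₂ : Dense (ι₂ ⁻¹' (Set.range ι₁)ᶜ))
    (h₁ : Scheme.HasResolution C) (h₂ : Scheme.HasResolution D) : Scheme.HasResolution X := by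
  obtain ⟨C', ρ₁, hprop₁, hbir₁, hreg₁⟩ := h₁
  obtain ⟨D', ρ₂, hprop₂, hbir₂, hreg₂⟩ := h₂
  haveI := hprop₁
  haveI := hprop₂
  exact ⟨C' ⨿ D', coprod.desc (ρ₁ ≫ ι₁) (ρ₂ ≫ ι₂), isProper_coprodDesc _ _,
    isBirational_coprodDesc_of_closed_cover ι₁ ι₂ hcov hd₁ hd₂ hbir₁ hbir₂, hreg₁.coprod hreg₂⟩

/-- Resolutions transport along isomorphisms of the target. [folklore] -/
theorem Scheme.HasResolution.of_iso {X Z : Scheme.{u}} (g : X ⟶ Z) [IsIso g]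
    (h : Scheme.HasResolution X) : Scheme.HasResolution Z := by
  obtain ⟨X', π, hprop, hbir, hreg⟩ := h
  haveI := hprop
  exact ⟨X', π ≫ g, inferInstance, hbir.comp_iso g, hreg⟩

end Glue

/-! ## Induction over the irreducible components -/

section Components

open Scheme.IdealSheafData

variable {X : Scheme.{u}}

/-- **Resolution of a finite union of irreducible components** of a reduced scheme, given a
resolution of each component with its reduced (hence integral) closed-subscheme structure
`(vanishingIdeal Z).subscheme` (induction on the number of components, gluing along
`hasResolution_of_closed_cover`).
[cite: CossartPiltant2019, proof of Prop. 4.6, Step 1 (arXiv v1: Prop. 4.4)] -/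
theorem hasResolution_subscheme_biUnion
    (hres : ∀ Z : Closeds X, (Z : Set X) ∈ irreducibleComponents X →
      Scheme.HasResolution (vanishingIdeal Z).subscheme)
    (S : Finset (Set X)) (hS : (S : Set (Set X)) ⊆ irreducibleComponents X) (T : Closeds X)
    (hT : (T : Set X) = ⋃ Z ∈ S, Z) :
    Scheme.HasResolution (vanishingIdeal T).subscheme := by
  classical
  induction S using Finset.induction_on generalizing T with
  | empty =>
    -- the subscheme is empty, hence regular
    have hT' : (T : Set X) = ∅ := by simpa using hT
    haveI : IsEmpty (vanishingIdeal T).subscheme := ⟨fun x => by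
      have := mem_of_subscheme_vanishingIdeal T x
      rw [← SetLike.mem_coe, hT'] at this
      exact this⟩
    exact Scheme.IsRegular.hasResolution fun x => (IsEmpty.false x).elim
  | insert Z S hZS ih =>
    have hZ : Z ∈ irreducibleComponents X := hS (Finset.mem_insert_self Z S)
    have hS' : (S : Set (Set X)) ⊆ irreducibleComponents X :=
      fun W hW => hS (Finset.mem_insert_of_mem hW)
    -- the two closed pieces: `Z` and the union `T₂` of the other components
    let T₁ : Closeds X := ⟨Z, isClosed_of_mem_irreducibleComponents Z hZ⟩
    let T₂ : Closeds X := ⟨⋃ W ∈ S, W, isClosed_biUnion_finset fun W hW =>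
      isClosed_of_mem_irreducibleComponents W (hS' hW)⟩
    have hT₁₂ : (T : Set X) = (T₁ : Set X) ∪ T₂ := by
      rw [hT, Finset.set_biUnion_insert]; rfl
    have h₁T : T₁ ≤ T := by
      intro x hx; rw [← SetLike.mem_coe, hT₁₂]; exact Or.inl hx
    have h₂T : T₂ ≤ T := by
      intro x hx; rw [← SetLike.mem_coe, hT₁₂]; exact Or.inr hx
    -- `Z ⊄ T₂` and `W ⊄ Z` for `W ∈ S`
    have hZT₂ : ¬ (Z ⊆ (T₂ : Set X)) := fun h =>
      hZS (mem_of_subset_biUnion_of_mem_irreducibleComponents hZ S hS' h)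
    have hWZ : ∀ W ∈ S, ¬ (W ⊆ Z) := by
      intro W hW h
      have : W = Z := Set.Subset.antisymm h ((hS' hW).2 hZ.1 h)
      exact hZS (this ▸ hW)
    -- the pieces as closed subschemes of `X_T`
    let ι₁ := inclusion (vanishingIdeal_antimono h₁T)
    let ι₂ := inclusion (vanishingIdeal_antimono h₂T)
    haveI : IsReduced (vanishingIdeal T).subscheme := isReduced_subscheme_vanishingIdeal T
    -- resolution of the component `Z`: hypothesis
    have h₁ : Scheme.HasResolution (vanishingIdeal T₁).subscheme := hres T₁ hZ
    -- resolution of the rest: induction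
    have h₂ := ih hS' T₂ rfl
    refine hasResolution_of_closed_cover ι₁ ι₂ ?_ ?_ ?_ h₁ h₂
    · -- jointly surjective
      refine Set.eq_univ_of_forall fun y => ?_
      have hy := mem_of_subscheme_vanishingIdeal T y
      rw [← SetLike.mem_coe, hT₁₂] at hy
      rcases hy with hy | hy
      · left; rw [range_inclusion]; exact hy
      · right; rw [range_inclusion]; exact hy
    · -- the complement of `T₂` is dense in `X_Z`
      rw [range_inclusion]
      have hopen :
          IsOpen (ι₁ ⁻¹' ((vanishingIdeal T).subschemeι ⁻¹' (T₂ : Set X))ᶜ) :=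
        (T₂.2.preimage (vanishingIdeal T).subschemeι.continuous).isOpen_compl.preimage
          ι₁.continuous
      haveI : IsIntegral (vanishingIdeal T₁).subscheme :=
        isIntegral_subscheme_vanishingIdeal T₁ hZ.1
      refine hopen.dense ?_
      obtain ⟨x, hxZ, hxT₂⟩ := Set.not_subset.mp hZT₂
      have hx : x ∈ Set.range (vanishingIdeal T₁).subschemeι := by
        rw [range_subschemeι_vanishingIdeal]; exact hxZ
      obtain ⟨c, rfl⟩ := hx
      refine ⟨c, ?_⟩
      show (vanishingIdeal T).subschemeι (ι₁ c) ∉ (T₂ : Set X)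
      rw [subschemeι_inclusion_apply]
      exact hxT₂
    · -- the complement of `Z` is dense in `X_{T₂}`
      rw [range_inclusion, dense_iff_inter_open]
      intro O' hO' hO'ne
      obtain ⟨O, hO, rfl⟩ :=
        (vanishingIdeal T₂).subschemeι.isClosedEmbedding.isInducing.isOpen_iff.mp hO'
      obtain ⟨d₀, hd₀⟩ := hO'ne
      have hd₀T : (vanishingIdeal T₂).subschemeι d₀ ∈ (T₂ : Set X) :=
        mem_of_subscheme_vanishingIdeal T₂ d₀
      obtain ⟨W, hW, hd₀W⟩ := Set.mem_iUnion₂.mp hd₀T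
      have hWirr : IsPreirreducible W := (hS' hW).1.2
      obtain ⟨x, hxW, hxO, hxZ⟩ := hWirr O Zᶜ hO
        (isClosed_of_mem_irreducibleComponents Z hZ).isOpen_compl ⟨_, hd₀W, hd₀⟩
        (by
          obtain ⟨x, hxW, hxZ⟩ := Set.not_subset.mp (hWZ W hW)
          exact ⟨x, hxW, hxZ⟩)
      have hx : x ∈ Set.range (vanishingIdeal T₂).subschemeι := by
        rw [range_subschemeι_vanishingIdeal]; exact Set.mem_iUnion₂.mpr ⟨W, hW, hxW⟩
      obtain ⟨d, rfl⟩ := hx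
      refine ⟨d, hxO, ?_⟩
      show (vanishingIdeal T).subschemeι (ι₂ d) ∉ (T₁ : Set X)
      rw [subschemeι_inclusion_apply]
      exact hxZ

/-- **Reduction of resolution to the irreducible components**: a reduced scheme with finitely
many irreducible components (e.g. a Noetherian scheme) has a resolution of singularities as soon
as each of its irreducible components, with the reduced (= integral) closed-subscheme structure,
has one. [cite: CossartPiltant2019, proof of Prop. 4.6, Step 1 (arXiv v1: Prop. 4.4)] -/
theorem hasResolution_of_irreducibleComponents (X : Scheme.{u}) [IsReduced X]
    (hfin : (irreducibleComponents (X : Type u)).Finite)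
    (hres : ∀ Z : Closeds X, (Z : Set X) ∈ irreducibleComponents X →
      Scheme.HasResolution (vanishingIdeal Z).subscheme) :
    Scheme.HasResolution X := by
  classical
  have h := hasResolution_subscheme_biUnion hres hfin.toFinset (by simp) ⊤ (by
    refine (Set.eq_univ_of_forall fun x => ?_).trans Set.top_eq_univ.symm |>.symm
    exact Set.mem_iUnion₂.mpr ⟨irreducibleComponent x,
      hfin.mem_toFinset.mpr (irreducibleComponent_mem_irreducibleComponents x),
      mem_irreducibleComponent⟩)
  haveI := isIso_subschemeι_vanishingIdeal_top (X := X)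
  exact Scheme.HasResolution.of_iso (vanishingIdeal (⊤ : Closeds X)).subschemeι h

/-- The integral closed subscheme on an irreducible component. [folklore] -/
theorem isIntegral_subscheme_of_mem_irreducibleComponents (Z : Closeds X)
    (hZ : (Z : Set X) ∈ irreducibleComponents X) : IsIntegral (vanishingIdeal Z).subscheme :=
  isIntegral_subscheme_vanishingIdeal Z hZ.1

end Components

/-! ## Reduction to integral closed subschemes -/

section Integral

open Scheme.IdealSheafData

variable {k : Type u} [Field k]

/-- A reduced `k`-scheme `X` of finite type has a resolution as soon as every integral closed
subscheme `Z ↪ X` has one (`X` is Noetherian, so it has finitely many irreducible components;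
apply `hasResolution_of_irreducibleComponents`).
[cite: CossartPiltant2019, proof of Prop. 4.6, Step 1 (arXiv v1: Prop. 4.4)] -/
theorem hasResolution_of_forall_closeds (X : Scheme.{u}) (f : X ⟶ Spec (.of k))
    [LocallyOfFiniteType f] [QuasiCompact f] [IsReduced X]
    (h : ∀ Z : Closeds X, IsIntegral (vanishingIdeal Z).subscheme →
      Scheme.HasResolution (vanishingIdeal Z).subscheme) :
    Scheme.HasResolution X := by
  haveI : IsLocallyNoetherian X := LocallyOfFiniteType.isLocallyNoetherian f
  haveI : CompactSpace X := QuasiCompact.compactSpace_of_compactSpace f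
  haveI : IsNoetherian X := {}
  exact hasResolution_of_irreducibleComponents X
    TopologicalSpace.NoetherianSpace.finite_irreducibleComponents
    fun Z hZ => h Z (isIntegral_subscheme_of_mem_irreducibleComponents Z hZ)

/-- **`ResolutionInChar p` is equivalent to its integral case** (resolve the components and
glue): resolution of singularities for all reduced separated schemes of finite type over the fields
of characteristic `p` already follows from the case of *integral* ones. This is
`resolutionInChar_iff_integral` of `ResolutionOfComponents.lean` with `IntegralResolutionInChar p`
unfolded. [cite: CossartPiltant2019, proof of Prop. 4.6, Step 1 (arXiv v1: Prop. 4.4)] -/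
theorem resolutionInChar_iff_integral (p : ℕ) :
    ResolutionInChar.{u} p ↔
      ∀ (k : Type u) [Field k] [CharP k p] (X : Scheme.{u}) (f : X ⟶ Spec (.of k)),
        IsSeparated f → LocallyOfFiniteType f → QuasiCompact f → IsIntegral X →
          Scheme.HasResolution X := by
  constructor
  · intro h k _ _ X f hsep hft hqc hint
    exact h k X f hsep hft hqc inferInstance
  · intro h k _ _ X f hsep hft hqc hred
    refine hasResolution_of_forall_closeds X f fun Z hZ => ?_
    exact h k _ ((vanishingIdeal Z).subschemeι ≫ f) inferInstance inferInstance inferInstance hZ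

/-- `Hironaka1964` (resolution in characteristic zero, weak form) is equivalent to its integral
case (`IntegralResolutionInChar 0` unfolded). [folklore] -/
theorem hironaka1964_iff_integral :
    Hironaka1964.{u} ↔
      ∀ (k : Type u) [Field k] [CharP k 0] (X : Scheme.{u}) (f : X ⟶ Spec (.of k)),
        IsSeparated f → LocallyOfFiniteType f → QuasiCompact f → IsIntegral X →
          Scheme.HasResolution X :=
  resolutionInChar_iff_integral 0

/-- The summit conjunct `ResolutionOfSingularities` is equivalent to resolution of *integral*
separated schemes of finite type over fields of every prime characteristic
(`IntegralResolutionInChar p` unfolded, universe `0`). [folklore] -/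
theorem resolutionOfSingularities_iff_integral :
    ResolutionOfSingularities ↔
      ∀ p : ℕ, p.Prime → ∀ (k : Type) [Field k] [CharP k p] (X : Scheme.{0})
        (f : X ⟶ Spec (.of k)),
        IsSeparated f → LocallyOfFiniteType f → QuasiCompact f → IsIntegral X →
          Scheme.HasResolution X := by
  simp only [ResolutionOfSingularities, resolutionInChar_iff_integral]

end Integral

end ComponentGluing

end Literature.AlgebraicGeometry.Resolution

end
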